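import Summits.PneNP.PneNP.Theorems.SfmBlMachineHat
import Summits.PneNP.PneNP.Theorems.SfmBlCylinderDP

/-!
# Line «sfm-bl», MACHINE LAYER M4-SEM (part 1): the machine's DP table IS the cylinder count (stmt-PneNP-20523)

FRONTIER F-N1c; nothing here bears on P vs NP.

For a leg list `xs` whose outputs are `< m` (the legs of one spot inside one pair `W`, with
`c_j = cOut xs j = #{x ∈ xs : x.1 = j}`), a prefix length `k` and prefix bits `T0 : List Bool` (cylinder
`{T : ∀ j < k, T j = T0.getD j false}`), the machine's table of `SfmBlMachineHat` satisfies
* `dpTab_getD` — `(dpTab k T0 xs m)[i] = #{T ∈ cyl : Σ_j c_j χ(T j) = i − |xs|}` for `i ≤ 2|xs|`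
  (induction along the outputs with p3's `SfmBl.dpCount_zero / succ_of_mem / succ_of_not_mem / final`;
  the out-of-range reads of `getZ` are `0` because `|Σ_{j<jj} c_j χ(T j)| ≤ |xs|`, `abs_partialSum_le`);
* `badCount_eq` — `badCount G k T0 m (ab, meet, xs) = #{T ∈ cyl : G·ab < (Σ_j c_j χ(T j))²}` (layer cake,
  `SfmBl.card_cylinder_filter_eq_sum` over `Icc (−|xs|) |xs|`).
Part 2 (`SfmBlMachineHatPairs`) identifies the pair records with the families `𝒲 s` of the pipeline.
-/

set_option linter.dupNamespace false -- `Summit.PneNP.PneNP.…`: summit = sub-problem name (D-0017 single-conjunct layout)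

namespace Summit.PneNP.PneNP.Theorems.SfmBlMachine

open Finset
open Summit.PneNP.PneNP.Theorems.CandCutNorm (boolSign boolSign_eq_one_or)
open Summit.PneNP.PneNP.Theorems.SfmBl (dpCount_zero dpCount_succ_of_mem dpCount_succ_of_not_mem dpCount_final
  card_cylinder_filter_eq_sum boolSign_true_eq boolSign_false_eq)

variable {m : ℕ}

/-! ## The coefficient vector `c_j = cOut xs j` -/

/-- `cOut` of a cons. -/
theorem cOut_cons (x : PLeg) (xs : List PLeg) (j : ℕ) : cOut (x :: xs) j = cOut xs j + (if x.1 = j then 1 else 0) := by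
  unfold cOut
  rw [List.filter_cons]
  by_cases h : x.1 = j
  · simp [h]
  · simp [h]

/-- **`Σ_j c_j = |xs|`** when every output is `< m`. -/
theorem sum_cOut_eq_length (xs : List PLeg) (hout : ∀ x ∈ xs, x.1 < m) : ∑ j : Fin m, cOut xs j.val = xs.length := by
  induction xs with
  | nil => simp [cOut]
  | cons x xs ih =>
    have hx : x.1 < m := hout x (by simp)
    rw [Finset.sum_congr rfl (fun j _ => cOut_cons x xs j.val), Finset.sum_add_distrib,
      ih (fun y hy => hout y (List.mem_cons_of_mem _ hy)), List.length_cons]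
    congr 1
    have : (Finset.univ.filter fun j : Fin m => x.1 = j.val) = {⟨x.1, hx⟩} := by
      ext j; simp [Fin.ext_iff, eq_comm]
    rw [Finset.sum_boole, this, Finset.card_singleton, Nat.cast_one]

/-- PARTIAL SIGNED SUMS ARE BOUNDED: `|Σ_{j < jj} c_j χ(T j)| ≤ |xs|`. -/
theorem abs_partialSum_le (xs : List PLeg) (hout : ∀ x ∈ xs, x.1 < m) (T : Fin m → Bool) (jj : ℕ) :
    |∑ j ∈ univ.filter (fun j : Fin m => (j : ℕ) < jj), (cOut xs j.val : ℤ) * boolSign (T j)| ≤ xs.length := by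
  calc |∑ j ∈ univ.filter (fun j : Fin m => (j : ℕ) < jj), (cOut xs j.val : ℤ) * boolSign (T j)|
      ≤ ∑ j ∈ univ.filter (fun j : Fin m => (j : ℕ) < jj), |(cOut xs j.val : ℤ) * boolSign (T j)| :=
        Finset.abs_sum_le_sum_abs _ _
    _ = ∑ j ∈ univ.filter (fun j : Fin m => (j : ℕ) < jj), (cOut xs j.val : ℤ) := by
        refine Finset.sum_congr rfl fun j _ => ?_
        rw [abs_mul]
        rcases boolSign_eq_one_or (T j) with h | h <;> simp [h]
    _ ≤ ∑ j : Fin m, (cOut xs j.val : ℤ) :=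
        Finset.sum_le_sum_of_subset_of_nonneg (Finset.filter_subset _ _) (fun j _ _ => by positivity)
    _ = xs.length := by rw [← Nat.cast_sum, sum_cOut_eq_length xs hout]

/-- The DP counts vanish outside `[−|xs|, |xs|]`. -/
theorem dpN_eq_zero (xs : List PLeg) (hout : ∀ x ∈ xs, x.1 < m) (Q : (Fin m → Bool) → Prop) [DecidablePred Q]
    (jj : ℕ) {v : ℤ} (hv : (xs.length : ℤ) < |v|) :
    (univ.filter fun T : Fin m → Bool =>
      Q T ∧ ∑ j ∈ univ.filter (fun j : Fin m => (j : ℕ) < jj), (cOut xs j.val : ℤ) * boolSign (T j) = v).card = 0 := by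
  rw [Finset.card_eq_zero, Finset.filter_eq_empty_iff]
  rintro T - ⟨-, h⟩
  have := abs_partialSum_le xs hout T jj
  rw [h] at this
  exact absurd (lt_of_lt_of_le hv this) (lt_irrefl _)

/-! ## Reading the table -/

/-- `getZ` of a table that tabulates `N` on `[−C, C]` (with `N = 0` outside) is `N (z − C)` everywhere. -/
theorem getZ_eq_of_tab (tab : List ℕ) (C : ℕ) (hlen : tab.length = 2 * C + 1) (N : ℤ → ℕ)
    (htab : ∀ i, i < 2 * C + 1 → tab.getD i 0 = N ((i : ℤ) - C)) (hN : ∀ v, (C : ℤ) < |v| → N v = 0) (z : ℤ) :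
    getZ tab z = N (z - C) := by
  unfold getZ
  split_ifs with hz
  · rw [hN]; rw [abs_of_neg (by omega)]; omega
  · by_cases hlt : z.toNat < 2 * C + 1
    · rw [htab _ hlt]; congr 1; omega
    · rw [List.getD_eq_default _ _ (by rw [hlen]; omega), hN]
      rw [abs_of_nonneg (by omega)]; omega

/-! ## The table is the cylinder count -/

/-- INVARIANT OF THE DP: after processing outputs `0, …, jj − 1`, entry `i` counts the signings frozen to `T₀`
on the fixed outputs (`< k`) and on the unprocessed window `[jj, m)` whose processed partial sum is `i − |xs|`. -/
theorem dpTab_foldl_spec (xs : List PLeg) (hout : ∀ x ∈ xs, x.1 < m) (k : ℕ) (T0 : List Bool) :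
    ∀ jj, jj ≤ m → ∀ i, i < 2 * xs.length + 1 →
      ((List.range jj).foldl (dpStep k T0 xs) (dpInit xs)).getD i 0
        = (univ.filter fun T : Fin m → Bool =>
            (∀ j : Fin m, (j ∈ univ.filter (fun j : Fin m => (j : ℕ) < k) ∨ jj ≤ (j : ℕ)) →
              T j = T0.getD j.val false) ∧
            ∑ j ∈ univ.filter (fun j : Fin m => (j : ℕ) < jj), (cOut xs j.val : ℤ) * boolSign (T j)
              = (i : ℤ) - xs.length).card := by
  intro jj
  induction jj with
  | zero =>
    intro _ i hi
    rw [List.range_zero, List.foldl_nil,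
      dpCount_zero (fun j : Fin m => (cOut xs j.val : ℤ)) (univ.filter fun j : Fin m => (j : ℕ) < k)
        (fun j => T0.getD j.val false) ((i : ℤ) - xs.length)]
    unfold dpInit
    rw [List.getD_eq_getElem _ _ (by simpa using hi)]
    simp only [List.getElem_map, List.getElem_range]
    by_cases h : i = xs.length
    · rw [if_pos h, if_pos (by rw [h]; ring)]
    · rw [if_neg h, if_neg (by omega)]
  | succ jj ih =>
    intro hjj i hi
    have hjm : jj < m := Nat.lt_of_succ_le hjj
    rw [List.range_succ, List.foldl_append, List.foldl_cons, List.foldl_nil]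
    set tab := (List.range jj).foldl (dpStep k T0 xs) (dpInit xs) with htab
    have hlen : tab.length = 2 * xs.length + 1 := by
      suffices h : ∀ (l : List ℕ) (t : List ℕ), (l.foldl (dpStep k T0 xs) t).length = t.length by
        rw [htab, h]; simp [dpInit]
      intro l
      induction l with
      | nil => intro t; rfl
      | cons j l ih' => intro t; rw [List.foldl_cons, ih', length_dpStep]
    -- the table read through `getZ`
    have hread : ∀ z : ℤ, getZ tab z = (univ.filter fun T : Fin m → Bool =>
        (∀ j : Fin m, (j ∈ univ.filter (fun j : Fin m => (j : ℕ) < k) ∨ jj ≤ (j : ℕ)) → T j = T0.getD j.val false) ∧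
        ∑ j ∈ univ.filter (fun j : Fin m => (j : ℕ) < jj), (cOut xs j.val : ℤ) * boolSign (T j)
          = z - xs.length).card := by
      intro z
      refine getZ_eq_of_tab tab xs.length hlen (fun v => (univ.filter fun T : Fin m → Bool =>
        (∀ j : Fin m, (j ∈ univ.filter (fun j : Fin m => (j : ℕ) < k) ∨ jj ≤ (j : ℕ)) → T j = T0.getD j.val false) ∧
        ∑ j ∈ univ.filter (fun j : Fin m => (j : ℕ) < jj), (cOut xs j.val : ℤ) * boolSign (T j) = v).card)
        (fun i' hi' => ih hjm.le i' hi') (fun v hv => dpN_eq_zero xs hout _ jj hv) z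
    -- the new entry
    rw [List.getD_eq_getElem _ _ (by rw [length_dpStep, hlen]; exact hi)]
    unfold dpStep
    simp only [List.getElem_map, List.getElem_range]
    unfold dpEntry
    by_cases hfix : jj < k
    · -- fixed output: a shift
      rw [if_pos hfix, hread,
        dpCount_succ_of_mem (fun j : Fin m => (cOut xs j.val : ℤ)) (univ.filter fun j : Fin m => (j : ℕ) < k)
          (fun j => T0.getD j.val false) hjm (by simp [hfix]) ((i : ℤ) - xs.length)]
      congr 2
      unfold cSgn
      by_cases hb : T0.getD jj false = true
      · rw [if_pos hb]; simp only [hb, boolSign_true_eq]; ring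
      · rw [if_neg hb]; simp only [Bool.not_eq_true] at hb; simp only [hb, boolSign_false_eq]; ring
    · -- free output: a convolution
      rw [if_neg hfix, hread, hread,
        dpCount_succ_of_not_mem (fun j : Fin m => (cOut xs j.val : ℤ)) (univ.filter fun j : Fin m => (j : ℕ) < k)
          (fun j => T0.getD j.val false) hjm (by simp [hfix]) ((i : ℤ) - xs.length)]
      congr 2
      · ring
      · ring

/-- **THE MACHINE'S TABLE IS THE CYLINDER COUNT**: for `i ≤ 2|xs|`,
`(dpTab k T0 xs m)[i] = #{T : (∀ j < k, T j = T0[j]) ∧ Σ_j c_j χ(T j) = i − |xs|}`. -/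
theorem dpTab_getD (xs : List PLeg) (hout : ∀ x ∈ xs, x.1 < m) (k : ℕ) (T0 : List Bool) (i : ℕ)
    (hi : i < 2 * xs.length + 1) :
    (dpTab k T0 xs m).getD i 0
      = (univ.filter fun T : Fin m → Bool =>
          (∀ j ∈ univ.filter (fun j : Fin m => (j : ℕ) < k), T j = T0.getD j.val false) ∧
          ∑ j, (cOut xs j.val : ℤ) * boolSign (T j) = (i : ℤ) - xs.length).card := by
  unfold dpTab
  rw [dpTab_foldl_spec xs hout k T0 m le_rfl i hi,
    dpCount_final (fun j : Fin m => (cOut xs j.val : ℤ)) (univ.filter fun j : Fin m => (j : ℕ) < k)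
      (fun j => T0.getD j.val false) ((i : ℤ) - xs.length)]

/-! ## The bad count is the layer cake -/

/-- List form of the layer cake: filtering the indexed table and summing the values. -/
theorem sum_map_snd_filter_zip_range (q : ℕ → Bool) : ∀ (l : List ℕ),
    ((((List.range l.length).zip l).filter fun p => q p.1).map Prod.snd).sum
      = ∑ i ∈ Finset.range l.length, if q i then l.getD i 0 else 0 := by
  intro l
  induction l using List.reverseRecOn with
  | nil => simp
  | append_singleton l a ih =>
    rw [List.length_append, List.length_singleton, List.range_succ,
      List.zip_append (by rw [List.length_range]), List.filter_append, List.map_append, List.sum_append, ih,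
      Finset.sum_range_succ]
    congr 1
    · refine Finset.sum_congr rfl fun i hi => ?_
      rw [Finset.mem_range] at hi
      rw [List.getD_append _ _ _ _ hi]
    · rw [List.getD_eq_getElem _ _ (by simp), List.getElem_append_right (le_refl _)]
      simp only [List.zip_cons_cons, List.zip_nil_right, List.filter_cons, Nat.sub_self, List.getElem_cons_zero]
      by_cases h : q l.length = true
      · simp [h]
      · simp [h]

/-- **THE MACHINE'S BAD COUNT IS THE NUMBER OF BAD COMPLETIONS**:
`badCount G k T0 m (ab, meet, xs) = #{T : (∀ j < k, T j = T0[j]) ∧ G·ab < (Σ_j c_j χ(T j))²}`. -/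
theorem badCount_eq (G k : ℕ) (T0 : List Bool) (ab meet : ℕ) (xs : List PLeg) (hout : ∀ x ∈ xs, x.1 < m) :
    badCount G k T0 m (ab, meet, xs)
      = (univ.filter fun T : Fin m → Bool =>
          (∀ j ∈ univ.filter (fun j : Fin m => (j : ℕ) < k), T j = T0.getD j.val false) ∧
          ((G * ab : ℕ) : ℤ) < (∑ j, (cOut xs j.val : ℤ) * boolSign (T j)) ^ 2).card := by
  unfold badCount
  simp only
  have hlen : (dpTab k T0 xs m).length = 2 * xs.length + 1 := length_dpTab k T0 xs m
  rw [← hlen, sum_map_snd_filter_zip_range, hlen]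
  -- the layer cake over `Icc (−C) C`, re-indexed by `i = v + C`
  rw [card_cylinder_filter_eq_sum (fun j : Fin m => (cOut xs j.val : ℤ)) (univ.filter fun j : Fin m => (j : ℕ) < k)
    (fun j => T0.getD j.val false) (fun v => ((G * ab : ℕ) : ℤ) < v ^ 2) (Finset.Icc (-(xs.length : ℤ)) xs.length)
    (fun T _ => by
      rw [Finset.mem_Icc, ← abs_le]
      have := abs_partialSum_le xs hout T m
      rwa [Finset.filter_true_of_mem (fun j _ => j.isLt)] at this)]
  rw [Finset.sum_filter]
  symm
  refine Finset.sum_nbij' (fun v => (v + xs.length).toNat) (fun i => (i : ℤ) - xs.length) (fun v hv => ?_)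
    (fun i hi => ?_) (fun v hv => ?_) (fun i hi => ?_) (fun v hv => ?_)
  · rw [Finset.mem_Icc] at hv; rw [Finset.mem_range]; omega
  · rw [Finset.mem_range] at hi; rw [Finset.mem_Icc]; constructor <;> omega
  · rw [Finset.mem_Icc] at hv; omega
  · rw [Finset.mem_range] at hi; omega
  · rw [Finset.mem_Icc] at hv
    have hidx : (v + xs.length).toNat < 2 * xs.length + 1 := by omega
    have hv' : (((v + xs.length).toNat : ℕ) : ℤ) - xs.length = v := by omega
    unfold badIdx
    rw [dpTab_getD xs hout k T0 _ hidx, hv']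
    simp only [decide_eq_true_eq, Nat.cast_mul]

end Summit.PneNP.PneNP.Theorems.SfmBlMachine
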